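import Literature.Analysis.FluidPDE.AncientL3BackwardLiouville
import Literature.Analysis.FluidPDE.AncientL3BackwardLiouvilleTools
import Literature.Analysis.FluidPDE.OseenAncientKatoClass
import Literature.Analysis.FluidPDE.NSSereginBlowupCore
import Literature.Analysis.FluidPDE.SereginSlabLayer
import Literature.Analysis.FluidPDE.SereginSverakBlowupSelection
import HarnessLib

/-!
# Albritton–Barker 2019, Thm. 1.2 — proof (`AlbrittonBarker2019_liouville_L3_backward_holds`)

Analysis/FluidPDE proof file (theorems only: no definition, no named fact, no `sorry`) discharging
the named fact `Literature.Analysis.FluidPDE.AlbrittonBarker2019_liouville_L3_backward`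
(`AncientL3BackwardLiouville.lean`; D. Albritton, T. Barker, *On local Type I singularities of the
Navier–Stokes equations and Liouville theorems*, J. Math. Fluid Mech. 21 (2019), Paper No. 43 =
arXiv:1811.00502, **Thm. 1.2**: "If `v` is a mild ancient solution satisfying
`sup_{k∈ℕ} ‖v(·,t_k)‖_{L³} < ∞` for a sequence of times `t_k ↓ −∞`, then `v ≡ 0`"), in the tree's
rendering over the bounded Oseen integral-equation class of KNSS 2009, §4 (i).

## The printed proof and the proof given here

Albritton–Barker prove Thm. 1.2 through Thm. 4.1 (§4, arXiv p. 9): zoom out,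
`v^{(k)}(x,t) = √|t_k| v(√|t_k| x, |t_k| t)` on `ℝ³ × ]−1, 0[`, so that `‖v^{(k)}(·,−1)‖ ≤ M`;
"since `v` is mild, it is not difficult to show that `v^{(k)}` is a weak `L^{3,∞}` solution";
by the compactness of such solutions with bounded data a subsequence converges, strongly in
`L³_loc`, to a solution `v^∞` whose final value is the distributional limit of
`v^{(k)}(·, 0) = U^{(k)} + W^{(k)}`, where "`U^{(k)} → 0` in the sense of distributions" (`U ∈ 𝔹`,
the class of `f` with `f(λ·) → 0` as `λ → ∞`, which contains `L³`); by backward uniqueness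
(Prop. 4.2) `v^∞` is essentially bounded near the final time; and if `v ≢ 0` then
`‖v^{(k)}‖_{L^∞(Q(1/2))} → ∞`, which by the **persistence of singularities** (Prop. 2.3) makes
`v^∞` singular — a contradiction. "Hence, `v ≡ 0`" (the bound (4.4),
`limsup √(|t_k|/2) ‖v‖_{L^∞(Q(√(|t_k|/2)))} < ∞`, un-scales to `v = 0` at every point).

The proof below is this argument, step for step, with the theory of weak `L^{3,∞}` solutions
replaced by the theory the tree already carries **proved** — Seregin's local energy solutions with
`L³` data on a short slab, exactly as assembled for Seregin's own zoom-*in* theorem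
(`seregin_blowup_core`, `NSSereginBlowupCore.lean`; Seregin, Comm. Math. Phys. 312 (2012), §§2–4):

1. *(`L³` data; "`v^{(k)}` is a weak solution".)* From each slice `v(τ_k) ∈ L³` the bounded
   Oseen-mild ancient solution is a Kato solution up to the final time
   (`oseenAncient_isKatoSolutionOn`, `OseenAncientKatoClass.lean`), and every slice `v(t)`, `t < 0`,
   lies in `L³` (`oseenAncient_memLp_three_of_le`).
2. *(Zoom out.)* For a final time `t₀ < 0` and a short `S > 0` (the a priori and initial-layer
   regime of the tree, `kato_apriori_localEnergy`, `katoLayer_of_ae` ∘ `katoLayerAE_of_slabLayer` ∘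
   `seregin_slabLayer`, depending only on `M`), the zoomed solutions
   `u_k(t, y) = λ_k v(τ_k + λ_k² t, λ_k y)`, `λ_k² = (t₀ − τ_k)/S → ∞`, are Kato solutions on
   `[0, S'_k)`, `S'_k > S` (`isKatoSolutionOn_blowup`), with `‖u_k(0)‖₃ = ‖v(τ_k)‖₃ ≤ M`
   (`eLpNorm_three_blowupData`) and `u_k(S) = λ_k v(t₀, λ_k ·)`.
3. *(Compactness.)* With their Riesz pressures they are local energy solutions on `ℝ³ × (0, S)`
   (`IsKatoSolutionOn.exists_finalTime_rieszPressure`, `.isLocalEnergySolutionOn_of_pressure`) with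
   uniform bounds, so the limiting procedure (`localLeray_compactness_fullInterval`) yields a local
   energy solution `v_∞` with `L³` datum, `u_{k_j} → v_∞` strongly in `L²_loc` and
   `u_{k_j}(t) → v_∞(t)` in `𝒟'` for every `t ∈ [0, S]`.
4. *(Final value; "`U^{(k)} → 0`".)* `v_∞(S) = lim λ v(t₀, λ·) = 0` in `𝒟'` since `v(t₀) ∈ L³`
   (`tendsto_integral_inner_zoomOut_of_memLp_three`, `AncientL3BackwardLiouvilleTools.lean`).
5. *(Backward uniqueness, Prop. 4.2.)* `v_∞ = 0` a.e. on `(0, S) × ℝ³`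
   (`lemarieRieusset_backward_uniqueness_slab_holds`, Lemarié-Rieusset 2016 Thm. 15.4, proved in the
   tree along Escauriaza–Seregin–Šverák).
6. *(Persistence of singularities, Prop. 2.3, quantitative.)* `v_∞` being bounded (by `0`) on a
   cylinder `Q_r(S, 0)`, the approximants are **uniformly** bounded, `|u_{k_j}| ≤ B` a.e. on
   `Q_{r₁}(S, 0)` for `j` large (`singular_point_stability_unit_bound`,
   `AncientL3BackwardLiouvilleTools.lean`).
7. *(Un-scaling, "Hence `v ≡ 0`".)* `ess sup_{Q_{λ r₁}(t₀, 0)} |v| ≤ B/λ` along `λ = λ_{k_j} → ∞`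
   (`eLpNorm_top_uncurry_blowup`); `v` is continuous, so `|v(t, x)| ≤ B/λ_{k_j}` for all large `j`
   at every `(t, x)` with `t < t₀` (`SereginSverak2009.forall_le_of_ae_le_of_continuousOn`), i.e.
   `v(t, x) = 0`; and `t₀ < 0` was arbitrary.

Main results: `albrittonBarker_liouville_L3_core` (steps 1–7 for a fixed final time `t₀`) and the
discharge `AlbrittonBarker2019_liouville_L3_backward_holds`. (The sibling
`AncientL3BackwardLiouvilleProofs.lean` serves the *other* fact of `AncientL3BackwardLiouville.lean`,
Thm. 4.1 in weak `L³`; the two discharge paths are independent.)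

## References

* D. Albritton, T. Barker, J. Math. Fluid Mech. 21 (2019), Paper No. 43 = arXiv:1811.00502: Thm. 1.2
  (arXiv p. 4); Prop. 2.3 (p. 5); §4, Thm. 4.1, Prop. 4.2 and the proof of Thm. 4.1 (p. 9).
  [`AlbrittonBarker2019`]
* G. Seregin, Comm. Math. Phys. 312 (2012) 833–845 = arXiv:1104.3615, §§2–4 (the zoom-in twin).
  [`Seregin2012CMP`]
* P. G. Lemarié-Rieusset, *The Navier–Stokes Problem in the 21st Century* (CRC 2016),
  doi:10.1201/b19556: Thm. 15.4, proof of Thm. 15.5 (PDF pp. 568–573), Thm. 14.4. [`LemarieRieusset2016`]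
* G. Koch, N. Nadirashvili, G. Seregin, V. Šverák, Acta Math. 203 (2009) = arXiv:0709.3599, §4 (i).
  [`KochNadirashviliSereginSverak2009`]
-/

noncomputable section

open MeasureTheory TopologicalSpace Set Function Filter Metric
open _root_.Topology
open scoped ENNReal NNReal RealInnerProductSpace

namespace Literature.Analysis.FluidPDE

set_option maxHeartbeats 3200000 in
/-- **Albritton–Barker 2019, Thm. 1.2, core form for a fixed final time** (arXiv:1811.00502, §4,
proof of Thm. 4.1 "by zooming out and the persistence of singularities", run over the tree's proved
local-energy machinery; see the module docstring for the seven steps and their sources). Let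
`v : ℝ → ℝ³ → ℝ³` be continuous and bounded by `K` on `(−∞, 0) × ℝ³`, with weakly divergence-free
slices, satisfying the Oseen integral identity `v(t) = e^{(t−s)Δ}v(s) − B¹_s(v, v)(t)` pointwise for
all `s < t < 0`; let `τ_k < 0`, `τ_k → −∞`, with `‖v(τ_k)‖₃ ≤ M`. Then for every `t₀ < 0`,
`v(t, x) = 0` for all `t < t₀` and all `x`. [cite: AlbrittonBarker2019, Thm. 1.2 and §4 (proof of Thm. 4.1, arXiv:1811.00502 p. 9), Prop. 2.3] [cite: Seregin2012CMP, §§2–4] -/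
theorem albrittonBarker_liouville_L3_core {v : ℝ → EuclideanSpace ℝ (Fin 3) → EuclideanSpace ℝ (Fin 3)} {K : ℝ}
    (hcont : ContinuousOn (uncurry v) (Iio 0 ×ˢ univ)) (hK : ∀ t < 0, ∀ x, ‖v t x‖ ≤ K)
    (hdiv : ∀ t < 0, IsWeaklyDivFree (v t))
    (hmild : ∀ s t : ℝ, s < t → t < 0 → ∀ x,
      v t x = UnboundedOperators.heatExtension (v s) (t - s) x - oseenDuhamel 1 s v v t x)
    {τ : ℕ → ℝ} {M : ℝ≥0} (hτ0 : ∀ k, τ k < 0) (hτ : Tendsto τ atTop atBot)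
    (hτM : ∀ k, eLpNorm (v (τ k)) 3 volume ≤ M) {t₀ : ℝ} (ht₀ : t₀ < 0) :
    ∀ t < t₀, ∀ x, v t x = 0 := by
  classical
  have hK0 : 0 ≤ K := (norm_nonneg _).trans (hK (-1) (by norm_num) 0)
  have hMcoe : ENNReal.ofReal (M : ℝ) = (M : ℝ≥0∞) := ENNReal.ofReal_coe_nnreal
  -- ### Step 1: `L³` slices and Kato solutions from them
  have h3τ : ∀ k, MemLp (v (τ k)) 3 volume := fun k =>
    ⟨(hcont.comp_continuous (f := fun x : EuclideanSpace ℝ (Fin 3) => (τ k, x)) (by fun_prop)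
        fun _ => ⟨hτ0 k, mem_univ _⟩).aestronglyMeasurable,
      (hτM k).trans_lt ENNReal.coe_lt_top⟩
  have h3all : ∀ t < 0, MemLp (v t) 3 volume := by
    intro t ht
    obtain ⟨k, hk⟩ := (hτ.eventually_le_atBot t).exists
    exact oseenAncient_memLp_three_of_le hcont hK hmild (h3τ k) hk ht
  -- ### constants: the a priori regime and the Kato layer for data bounded by `M`
  obtain ⟨ε₀, hε₀, Cap, hap⟩ := kato_apriori_localEnergy
  obtain ⟨S₀, hS₀, η, hη, hLM⟩ :=
    katoLayer_of_ae (fun M' => katoLayerAE_of_slabLayer seregin_slabLayer M') M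
  have hε₀r : (0 : ℝ) < ε₀ := by exact_mod_cast hε₀
  set S : ℝ := min (min ((ε₀ : ℝ) / 4) ((ε₀ : ℝ) / (4 * (((M : ℝ) ^ 2) ^ 2 + 1)))) (S₀ / 2)
    with hS_def
  have hS : 0 < S := lt_min (lt_min (by positivity) (by positivity)) (by positivity)
  have h2Sε : 2 * S ≤ (ε₀ : ℝ) := by
    have : S ≤ (ε₀ : ℝ) / 4 := (min_le_left _ _).trans (min_le_left _ _)
    linarith
  have h2SM : 2 * S * (((M : ℝ) ^ 2) ^ 2) ≤ (ε₀ : ℝ) := by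
    have h1 : S ≤ (ε₀ : ℝ) / (4 * (((M : ℝ) ^ 2) ^ 2 + 1)) :=
      (min_le_left _ _).trans (min_le_right _ _)
    have h2 : 0 ≤ ((M : ℝ) ^ 2) ^ 2 := by positivity
    calc 2 * S * (((M : ℝ) ^ 2) ^ 2)
        ≤ 2 * ((ε₀ : ℝ) / (4 * (((M : ℝ) ^ 2) ^ 2 + 1))) * (((M : ℝ) ^ 2) ^ 2) := by gcongr
      _ ≤ (ε₀ : ℝ) := by
          rw [mul_div_assoc', div_mul_eq_mul_div, div_le_iff₀ (by positivity)]
          nlinarith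
  have hSS₀ : S < S₀ := (min_le_right _ _).trans_lt (by linarith)
  -- ### Step 2: the tail of the sequence below `t₀`, the scales, the zoomed solutions
  obtain ⟨k₀, hk₀⟩ := (hτ.eventually_lt_atBot t₀).exists_forall_of_atTop
  set σ : ℕ → ℝ := fun k => τ (k + k₀) with hσ_def
  have hσt₀ : ∀ k, σ k < t₀ := fun k => hk₀ (k + k₀) (Nat.le_add_left _ _)
  have hσ0 : ∀ k, σ k < 0 := fun k => (hσt₀ k).trans ht₀
  have hσ : Tendsto σ atTop atBot := hτ.comp (tendsto_add_atTop_nat k₀)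
  have hσM : ∀ k, eLpNorm (v (σ k)) 3 volume ≤ M := fun k => hτM (k + k₀)
  set lam : ℕ → ℝ := fun k => Real.sqrt ((t₀ - σ k) / S) with hlam_def
  have hlarg : ∀ k, 0 < (t₀ - σ k) / S := fun k => div_pos (sub_pos.2 (hσt₀ k)) hS
  have hlam : ∀ k, 0 < lam k := fun k => Real.sqrt_pos.2 (hlarg k)
  have hlam2 : ∀ k, lam k ^ 2 = (t₀ - σ k) / S := fun k => Real.sq_sqrt (hlarg k).le
  have hlamtop : ∀ k, σ k + lam k ^ 2 * S = t₀ := fun k => by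
    rw [hlam2 k]; field_simp; ring
  have hlaminf : Tendsto lam atTop atTop := by
    have h1 : Tendsto (fun k => t₀ - σ k) atTop atTop := by
      have h0 : Tendsto (fun k => -σ k) atTop atTop := tendsto_neg_atBot_atTop.comp hσ
      have h0' := tendsto_atTop_add_const_left atTop t₀ h0
      simpa only [sub_eq_add_neg] using h0'
    exact Real.tendsto_sqrt_atTop.comp (h1.atTop_div_const hS)
  set ak : ℕ → EuclideanSpace ℝ (Fin 3) → EuclideanSpace ℝ (Fin 3) := fun k x => lam k • v (σ k) ((0 : EuclideanSpace ℝ (Fin 3)) + lam k • x) with hak_def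
  set uk : ℕ → ℝ → EuclideanSpace ℝ (Fin 3) → EuclideanSpace ℝ (Fin 3) :=
    fun k t x => lam k • v (σ k + lam k ^ 2 * t) ((0 : EuclideanSpace ℝ (Fin 3)) + lam k • x) with huk_def
  have huk_apply : ∀ k t x, uk k t x = lam k • v (σ k + lam k ^ 2 * t) ((0 : EuclideanSpace ℝ (Fin 3)) + lam k • x) :=
    fun k t x => rfl
  -- Kato solutions on the long intervals `[0, (0 - σ k)/λ_k²)`, on `[0, S'' k)` and on `[0, S)`
  have hKatoL : ∀ k, IsKatoSolutionOn ((0 - σ k) / lam k ^ 2) 1 (ak k) (uk k) := fun k =>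
    isKatoSolutionOn_blowup (oseenAncient_isKatoSolutionOn hcont hK hdiv hmild (h3τ (k + k₀)))
      (hlam k) 0
  have hSlt : ∀ k, S < (0 - σ k) / lam k ^ 2 := by
    intro k
    rw [hlam2 k, lt_div_iff₀ (hlarg k), zero_sub, mul_comm, div_mul_eq_mul_div,
      div_lt_iff₀ hS]
    nlinarith [hσt₀ k, hS]
  set S'' : ℕ → ℝ := fun k => min ((0 - σ k) / lam k ^ 2) (2 * S) with hS''_def
  have hS''S : ∀ k, S < S'' k := fun k => lt_min (hSlt k) (by linarith)
  have hS''pos : ∀ k, 0 < S'' k := fun k => hS.trans (hS''S k)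
  have hS''2 : ∀ k, S'' k ≤ 2 * S := fun k => min_le_right _ _
  have hS''ε : ∀ k, S'' k ≤ (ε₀ : ℝ) := fun k => (hS''2 k).trans h2Sε
  have hS''M : ∀ k, S'' k * (((M : ℝ) ^ 2) ^ 2) ≤ (ε₀ : ℝ) := fun k =>
    (mul_le_mul_of_nonneg_right (hS''2 k) (by positivity)).trans h2SM
  have hKatoS'' : ∀ k, IsKatoSolutionOn (S'' k) 1 (ak k) (uk k) := fun k =>
    (hKatoL k).mono (min_le_left _ _)
  have hKatoS : ∀ k, IsKatoSolutionOn S 1 (ak k) (uk k) := fun k =>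
    (hKatoS'' k).mono (hS''S k).le
  -- the data
  have hakM : ∀ k, eLpNorm (ak k) 3 volume ≤ M := fun k => by
    rw [hak_def]
    dsimp only
    rw [eLpNorm_three_blowupData _ (hlam k)]
    exact hσM k
  have hak : ∀ k, MemLp (ak k) 3 volume ∧ eLpNorm (ak k) 3 volume ≤ ENNReal.ofReal (M : ℝ) ∧
      IsWeaklyDivFree (ak k) := fun k =>
    ⟨(hKatoS k).memLp_initial hS, by rw [hMcoe]; exact hakM k, (hKatoS k).isWeaklyDivFree_initial hS⟩
  have hakbd : ∀ k, ∀ᵐ y ∂(volume : Measure (EuclideanSpace ℝ (Fin 3))), ‖ak k y‖ ≤ lam k * K := fun k =>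
    ae_of_all _ fun y => by
      rw [hak_def]
      dsimp only
      rw [norm_smul, Real.norm_eq_abs, abs_of_pos (hlam k)]
      exact mul_le_mul_of_nonneg_left (hK _ (hσ0 k) _) (hlam k).le
  -- ### Step 3: uniform local energy bounds, pressures, the local energy class, compactness
  set CE : ℝ≥0 := 2 * (Cap * M ^ 2) with hCE
  set CG : ℝ≥0 := Cap * M ^ 2 with hCG_def
  set C : ℝ≥0 := max CE CG with hC_def
  have hCEcoe : ((CE : ℝ≥0) : ℝ≥0∞) = 2 * ((Cap * M ^ 2 : ℝ≥0) : ℝ≥0∞) := by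
    rw [hCE, hCG_def]; push_cast; ring
  have hCEC : ((CE : ℝ≥0) : ℝ≥0∞) ≤ C := ENNReal.coe_le_coe.2 (le_max_left _ _)
  have hCGC : ((CG : ℝ≥0) : ℝ≥0∞) ≤ C := ENNReal.coe_le_coe.2 (le_max_right _ _)
  have hapk := fun k => hap M (S'' k) (ak k) (uk k) (hKatoS'' k) (hakM k) (hS''pos k) (hS''ε k)
    (hS''M k)
  have hexk : ∀ k, ∃ P : ℝ → EuclideanSpace ℝ (Fin 3) → ℝ,
      AEStronglyMeasurable (uncurry P) (volume.restrict (Ioo 0 (S'' k) ×ˢ (univ : Set (EuclideanSpace ℝ (Fin 3))))) ∧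
      (∫⁻ z in Ioo 0 (S'' k) ×ˢ (univ : Set (EuclideanSpace ℝ (Fin 3))), ‖uk k z.1 z.2‖ₑ ^ (3 : ℝ) < ∞) ∧
      (∫⁻ z in Ioo 0 (S'' k) ×ˢ (univ : Set (EuclideanSpace ℝ (Fin 3))), ‖P z.1 z.2‖ₑ ^ (3 / 2 : ℝ) < ∞) ∧
      (∀ S' ∈ Ioo 0 (S'' k), IsSuitableWeakSolutionOn
        (slab (EuclideanSpace ℝ (Fin 3)) (Ioo 0 S') isOpen_Ioo) 1 0 (uk k) P) ∧
      IsSuitableWeakSolutionOn (slab (EuclideanSpace ℝ (Fin 3)) (Ioo 0 (S'' k)) isOpen_Ioo) 1 0 (uk k) P := fun k =>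
    (hKatoS'' k).exists_finalTime_rieszPressure (hS''pos k) (hakbd k)
  choose Pk hPkm hL3k hP32k hsuitk' hsuitkS using hexk
  have hclass : ∀ k, IsLocalEnergySolutionOn S 1 (ak k) (uk k) (Pk k) := fun k =>
    (hKatoS'' k).isLocalEnergySolutionOn_of_pressure hS (hS''S k) (hsuitk' k S ⟨hS, hS''S k⟩)
      ((lintegral_mono_set (prod_mono (Ioo_subset_Ioo_right (hS''S k).le) Subset.rfl)).trans_lt
        (hP32k k))
  -- inputs of the limiting procedure
  have hC' : ∀ k, ∀ t ∈ Icc 0 S, ∀ x₀ : (EuclideanSpace ℝ (Fin 3)), ∫⁻ x in ball x₀ 1, ‖uk k t x‖ₑ ^ 2 ≤ C := by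
    intro k t ht x₀
    refine le_trans ?_ hCEC
    rw [hCEcoe]
    exact (hapk k).1 t ⟨ht.1, ht.2.trans_lt (hS''S k)⟩ x₀
  have hG' : ∀ k, ∃ G : ℝ → EuclideanSpace ℝ (Fin 3) → EuclideanSpace ℝ (Fin 3) →L[ℝ] (EuclideanSpace ℝ (Fin 3)),
      HasWeakSpatialGradientOn (slab (EuclideanSpace ℝ (Fin 3)) (Ioo 0 S) isOpen_Ioo) (uk k) G ∧
        ∀ x₀ : (EuclideanSpace ℝ (Fin 3)), ∫⁻ z in Ioo 0 S ×ˢ ball x₀ 1,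
          ENNReal.ofReal (frobeniusNormSq (G z.1 z.2)) ≤ C := by
    intro k
    obtain ⟨G, hG, -⟩ := (hclass k).uniformLocalGradient
    exact ⟨G, hG, fun x₀ => ((hapk k).2 S ⟨hS, hS''S k⟩ G hG x₀).trans hCGC⟩
  have hlayer' : ∀ k, ∀ t ∈ Ioo 0 S, ∀ x₀ : (EuclideanSpace ℝ (Fin 3)),
      eLpNorm (uk k t - heatTest 1 (ak k) t) 2 (volume.restrict (ball x₀ 1)) ≤ η t :=
    fun k t ht x₀ => hLM (S'' k) (ak k) (uk k) (hKatoS'' k) (hakM k) t ⟨ht.1, ht.2.trans (hS''S k)⟩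
      (ht.2.trans hSS₀) x₀
  -- the limiting procedure
  obtain ⟨φ, aL, vL, πL, hφ, haL3, -, haLdiv, hvL, -, -, hvLw, hvLs⟩ :=
    localLeray_compactness_fullInterval one_pos hS (M : ℝ) C η hη ak uk Pk hak hclass hC' hG'
      hlayer'
  -- ### Step 4: the final value of the limit vanishes
  have hfinal : vL S =ᵐ[volume] 0 := by
    refine FunctionSpaces.ae_eq_zero_of_forall_integral_inner_test_eq_zero
      (hvL.locallyIntegrable_slice ⟨hS.le, le_rfl⟩) fun ψ hψ => ?_
    have h1 := hvLw S ⟨hS.le, le_rfl⟩ ψ hψ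
    have h2 : (fun k => ∫ x, ⟪uk (φ k) S x, ψ x⟫) =
        fun k => ∫ x, ⟪lam (φ k) • v t₀ ((0 : EuclideanSpace ℝ (Fin 3)) + lam (φ k) • x), ψ x⟫ := by
      funext k
      simp only [huk_apply, hlamtop]
    rw [h2] at h1
    have h3 := tendsto_integral_inner_zoomOut_of_memLp_three (h3all t₀ ht₀) hψ 0
      (fun k => hlam (φ k)) (hlaminf.comp hφ.tendsto_atTop)
    exact tendsto_nhds_unique h1 h3
  have hfinal' : ∀ ψ : (EuclideanSpace ℝ (Fin 3)) → EuclideanSpace ℝ (Fin 3), FunctionSpaces.IsTestFunctionOn (⊤ : Opens (EuclideanSpace ℝ (Fin 3))) ψ →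
      Tendsto (fun t => ∫ x, ⟪vL t x, ψ x⟫) (𝓝[<] S) (𝓝 0) := by
    intro ψ hψ
    have h1 : Tendsto (fun t => ∫ x, ⟪vL t x, ψ x⟫) (𝓝[Icc (0 : ℝ) S] S)
        (𝓝 (∫ x, ⟪vL S x, ψ x⟫)) := ((hvL.weakContinuous ψ hψ) S ⟨hS.le, le_rfl⟩).tendsto
    have h0 : ∫ x, ⟪vL S x, ψ x⟫ = 0 := by
      rw [integral_congr_ae (show (fun x => ⟪vL S x, ψ x⟫) =ᵐ[volume] fun _ => (0 : ℝ) from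
        hfinal.mono fun x hx => by simp [hx])]
      exact integral_zero _ _
    rw [h0] at h1
    have hfilter : 𝓝[<] (S : ℝ) = 𝓝[Ioo (0 : ℝ) S] S := by
      rw [← nhdsWithin_inter_of_mem' (mem_nhdsWithin_of_mem_nhds (Ioi_mem_nhds hS)),
        Iio_inter_Ioi]
    rw [hfilter]
    exact h1.mono_left (nhdsWithin_mono _ Ioo_subset_Icc_self)
  -- ### Step 5: backward uniqueness — the limit vanishes on the slab
  have hzero : ∀ᵐ z ∂(volume.restrict (Ioo (0 : ℝ) S ×ˢ (univ : Set (EuclideanSpace ℝ (Fin 3))))), vL z.1 z.2 = 0 :=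
    lemarieRieusset_backward_uniqueness_slab_holds one_pos hS haL3 haLdiv hvL.isLocalLeraySolutionOn
      hfinal'
  have hae0 : uncurry vL =ᵐ[volume.restrict (Ioo (0 : ℝ) S ×ˢ (univ : Set (EuclideanSpace ℝ (Fin 3))))]
      (0 : ℝ × EuclideanSpace ℝ (Fin 3) → EuclideanSpace ℝ (Fin 3)) := hzero.mono fun z hz => hz
  -- a small admissible radius at the vertex `(S, 0)`
  set r : ℝ := min (1 / 2) (Real.sqrt S / 2) with hr_def
  have hsq : 0 < Real.sqrt S := Real.sqrt_pos.2 hS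
  have hr : 0 < r := lt_min (by norm_num) (by positivity)
  have hrS : r ^ 2 < S := by
    have h1 : r ≤ Real.sqrt S / 2 := min_le_right _ _
    have h2 : r ^ 2 ≤ (Real.sqrt S / 2) ^ 2 := pow_le_pow_left₀ hr.le h1 2
    have h3 : (Real.sqrt S / 2) ^ 2 = S / 4 := by rw [div_pow, Real.sq_sqrt hS.le]; norm_num
    linarith
  have hsub : parabolicCylinder r ((S : ℝ), (0 : EuclideanSpace ℝ (Fin 3))) ⊆ Ioo (0 : ℝ) S ×ˢ (univ : Set (EuclideanSpace ℝ (Fin 3))) := by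
    intro z hz
    rw [mem_parabolicCylinder] at hz
    exact ⟨⟨by nlinarith [hz.1.1], hz.1.2⟩, mem_univ _⟩
  have h0 : eLpNorm (uncurry vL) ∞ (volume.restrict (parabolicCylinder r ((S : ℝ), (0 : EuclideanSpace ℝ (Fin 3))))) = 0 := by
    rw [eLpNorm_congr_ae (hae0.filter_mono (ae_mono (Measure.restrict_mono hsub le_rfl)))]
    exact eLpNorm_zero
  -- ### Step 6: persistence of singularities, quantitative — a bound uniform in `k`
  obtain ⟨r₁, hr₁, B, hev⟩ := singular_point_stability_unit_bound hS C
    (fun k => ak (φ k)) (fun k => uk (φ k)) (fun k => Pk (φ k)) aL vL πL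
    (fun k => (hclass (φ k)).isLocalLeraySolutionOn) hvL.isLocalLeraySolutionOn
    (fun k => (ae_restrict_mem measurableSet_Ioo).mono fun t ht y =>
      hC' (φ k) t ⟨ht.1.le, ht.2.le⟩ y)
    (fun k => hG' (φ k)) hvLs 0 ⟨r, hr, hrS, by rw [h0]; exact ENNReal.zero_lt_top⟩
  set B' : ℝ := max B 0 with hB'
  have hB'0 : 0 ≤ B' := le_max_right _ _
  -- ### Step 7: un-scaling, and the pointwise bound by continuity
  have hQsub : ∀ ρ : ℝ, parabolicCylinder ρ ((t₀ : ℝ), (0 : EuclideanSpace ℝ (Fin 3))) ⊆ Iio (0 : ℝ) ×ˢ (univ : Set (EuclideanSpace ℝ (Fin 3))) :=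
    fun ρ z hz => by
      rw [mem_parabolicCylinder] at hz
      exact ⟨hz.1.2.trans ht₀, mem_univ _⟩
  have hpt : ∀ᶠ k in atTop, ∀ z ∈ parabolicCylinder (lam (φ k) * r₁) ((t₀ : ℝ), (0 : EuclideanSpace ℝ (Fin 3))),
      ‖uncurry v z‖ ≤ B' / lam (φ k) := by
    filter_upwards [hev] with k hk
    have hl := hlam (φ k)
    -- the ess sup of the zoomed solution on `Q_{r₁}(S, 0)`
    have h1 : eLpNorm (uncurry (uk (φ k))) ∞
        (volume.restrict (parabolicCylinder r₁ ((S : ℝ), (0 : EuclideanSpace ℝ (Fin 3))))) ≤ ENNReal.ofReal B' := by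
      rw [eLpNorm_exponent_top]
      exact eLpNormEssSup_le_of_ae_bound (hk.mono fun w hw => hw.trans (le_max_left _ _))
    -- un-scale: `Q_{r₁}(S, 0)` is the image of `Q_{λ r₁}(t₀, 0)`
    rw [huk_def] at h1
    dsimp only at h1
    rw [eLpNorm_top_uncurry_blowup v hl (σ (φ k)) 0 r₁ S 0, smul_zero, add_zero, hlamtop] at h1
    have h2 : eLpNorm (uncurry v) ∞
        (volume.restrict (parabolicCylinder (lam (φ k) * r₁) ((t₀ : ℝ), (0 : EuclideanSpace ℝ (Fin 3))))) ≤
          ENNReal.ofReal (B' / lam (φ k)) := by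
      rw [Real.enorm_eq_ofReal hl.le] at h1
      rw [ENNReal.ofReal_div_of_pos hl, ENNReal.le_div_iff_mul_le (Or.inl (ENNReal.ofReal_pos.2 hl).ne')
        (Or.inl ENNReal.ofReal_ne_top), mul_comm]
      exact h1
    have h3 : ∀ᵐ z ∂(volume.restrict (parabolicCylinder (lam (φ k) * r₁) ((t₀ : ℝ), (0 : EuclideanSpace ℝ (Fin 3))))),
        ‖uncurry v z‖ ≤ B' / lam (φ k) := by
      filter_upwards [ae_enorm_le_eLpNorm_top v _] with z hz
      have hz' := hz.trans h2
      rwa [← ofReal_norm, ENNReal.ofReal_le_ofReal_iff (by positivity)] at hz'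
    exact SereginSverak2009.forall_le_of_ae_le_of_continuousOn (μ := (volume : Measure (ℝ × EuclideanSpace ℝ (Fin 3))))
      (isOpen_parabolicCylinder _ _) ((hcont.mono (hQsub _)).norm) continuousOn_const h3
  -- ### conclusion at a point `(t, x)`, `t < t₀`
  intro t ht x
  have hlφ : Tendsto (fun k => lam (φ k)) atTop atTop := hlaminf.comp hφ.tendsto_atTop
  have hmem : ∀ᶠ k in atTop,
      ((t, x) : ℝ × EuclideanSpace ℝ (Fin 3)) ∈ parabolicCylinder (lam (φ k) * r₁) ((t₀ : ℝ), (0 : EuclideanSpace ℝ (Fin 3))) := by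
    have h1 := (hlφ.atTop_mul_const hr₁).eventually_gt_atTop (max ‖x‖ (Real.sqrt (t₀ - t)))
    filter_upwards [h1] with k hk
    have hkx : ‖x‖ < lam (φ k) * r₁ := (le_max_left _ _).trans_lt hk
    have hkt : Real.sqrt (t₀ - t) < lam (φ k) * r₁ := (le_max_right _ _).trans_lt hk
    have hkt' : t₀ - t < (lam (φ k) * r₁) ^ 2 := by
      have h0 : 0 ≤ Real.sqrt (t₀ - t) := Real.sqrt_nonneg _
      have := Real.sq_sqrt (sub_pos.2 ht).le
      nlinarith
    rw [mem_parabolicCylinder]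
    refine ⟨⟨by simpa using (by linarith : t₀ - (lam (φ k) * r₁) ^ 2 < t), ht⟩, ?_⟩
    simpa [dist_zero_right] using hkx
  have hbound : ∀ᶠ k in atTop, ‖v t x‖ ≤ B' / lam (φ k) := by
    filter_upwards [hpt, hmem] with k hk hm using hk (t, x) hm
  have hlim : Tendsto (fun k => B' / lam (φ k)) atTop (𝓝 0) := by
    simpa [div_eq_mul_inv] using hlφ.inv_tendsto_atTop.const_mul B'
  exact norm_le_zero_iff.1 (ge_of_tendsto hlim hbound)

/-- **Discharge of `AlbrittonBarker2019_liouville_L3_backward`** (Albritton–Barker 2019, Thm. 1.2,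
J. Math. Fluid Mech. 21 (2019) no. 43 = arXiv:1811.00502 p. 4, proof §4 p. 9): for `t < 0` apply
`albrittonBarker_liouville_L3_core` with the final time `t₀ = t/2 ∈ (t, 0)`; the finite bound
`M < ∞` in `ℝ≥0∞` is the `ℝ≥0` bound `M.toNNReal`. [cite: AlbrittonBarker2019, Thm. 1.2 (arXiv:1811.00502 p. 4; proof §4 p. 9 via Thm. 4.1 and Prop. 2.3)] -/
theorem AlbrittonBarker2019_liouville_L3_backward_holds : AlbrittonBarker2019_liouville_L3_backward := by
  intro v hcont hbdd hdiv hmild hseq t ht x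
  obtain ⟨K, hK⟩ := hbdd
  obtain ⟨τ, M, hM, hτ, hτ0, hτM⟩ := hseq
  have hτM' : ∀ k, eLpNorm (v (τ k)) 3 volume ≤ (M.toNNReal : ℝ≥0∞) := fun k => by
    rw [ENNReal.coe_toNNReal hM.ne]
    exact hτM k
  exact albrittonBarker_liouville_L3_core hcont hK hdiv hmild hτ0 hτ hτM' (by linarith : t / 2 < 0)
    t (by linarith) x

end Literature.Analysis.FluidPDE

end
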